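import Summits.BirchSwinnertonDyer.Rank1Residual.ManinAdditive.ShimuraIndexFrickeLaw
import Literature.NumberTheory.Automorphic.ShimuraCurveRibetTakahashiOptimalModularityProofs
import Literature.NumberTheory.EllipticCurves.BurungaleSkinner2023.X011TwistsCertificateProofs
import Literature.NumberTheory.EllipticCurves.CuspFormTwist
import Literature.NumberTheory.EllipticCurves.PAdicLFunctionDistributionProofs
import Literature.NumberTheory.EllipticCurves.ComplexMultiplicationLocalFactorsAux
import Literature.NumberTheory.EllipticCurves.LFunctionPrimeCoeff
import HarnessLib

/-!
# The Shimura quotient `Λ₀(f)/Λ₁(f)` at level `11` and the non-vacuity of the squarefree Shimura-`5` locus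
# (cell `bsd-f2-manin`, es lens, gen 45 — MEMO-es §69; answer to ref1 §R264 R-es-45 (b))

CONTEXT.  T-es-98 (`…Theorems.ManinLocalTwoThreeShimuraFiveSquarefreeHolds`, p780436) proves, fact-free,
`ShimuraFiveSquarefreeOnlyAtEleven`: a squarefree level `N` carrying a lattice-optimal `X₀(N)`-datum with
`¬ ShimuraIndexPrimeTo 5 D.f` (`5 ∣ [Λ₀(f) : Λ₁(f)]`) is `N = 11`.  ref1 asked whether that hypothesis is INHABITED in
the tree.  This file settles what the tree can say without new named facts:

§1 (fact-free, level `11`, pure `(ℤ/11)ˣ`-bookkeeping on Manin's homomorphism `γ ↦ {∞, γ∞}_f`):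
  * `5·Λ₀(f) ⊆ Λ₁(f)` for EVERY `f ∈ S₂(Γ₀(11))` (`u⁵ = ±1` in `𝔽₁₁ˣ`);
  * `Λ₀(f) = ℤ·{∞, γ∞}_f + Λ₁(f)` for any `γ ∈ Γ₀(11)` with `d_γ ≡ 2 (mod 11)` (`2` generates `𝔽₁₁ˣ`), and every
    `z ∈ Λ₀(f)` is `≡ k·{∞, γ∞}_f (mod Λ₁(f))` with `k < 5`: **`[Λ₀(f) : Λ₁(f)] ∈ {1, 5}`**;
  * hence **`ShimuraIndexPrimeTo 5 f ↔ Λ₀(f) = Λ₁(f) ↔ {∞, γ∞}_f ∈ Λ₁(f)`** (`d_γ ≡ 2`): at level `11` the Shimura-`5`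
    condition is the single membership question «is the `d ≡ 2` period a `Γ₁(11)`-period?».
§2 (typed candidates + the conditional inhabitant):
  * E-es-244 `ShimuraFiveNonVacuousAtEleven`: `Λ₁(f) ≠ Λ₀(f)` for every `f ≠ 0` in `S₂(Γ₀(11))` — IN PRINT (`X₁(11) → X₀(11)`
    is the `5`-isogeny `11a3 → 11a1`, `Λ₁ = Λ(11a3) ⊊ Λ₀ = Λ(11a1)`; Conrad–Edixhoven–Stein 2003 Table 4 row `11A`:
    `L(A_f,1)/Ω = 1/5²` on `J₁(11)` against Cremona's `L/Ω = 1/5` on `J₀(11)`), NOT provable from the tree's lattice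
    formalism alone (it needs the genus-one / Albanese input for `X₁(11)` or certified period numerics) — typed here;
  * E-es-245 `ShimuraFiveNonVacuousAtElevenData` (datum form, PROVED ⟸ E-es-244);
  * E-es-246 `ShimuraFiveNonVacuousAtElevenLValue` (es-lens form «`5·L(f,1) ∉ Λ₁(f)`»); §3 PROVES, fact-free, `a₂(11a) = −2`
    (point count `#Ẽ(𝔽₂) = 5`), Manin + Hecke `{∞, γ₂∞}_f = (a₂ − 3)·{∞,0}_f = −5·L(f,1)` for `γ₂ = (6 1; 11 2)`, and hence
    on the `11a`-newform «`5 ∤ [Λ₀:Λ₁]` ⟺ `5·L(f,1) ∈ Λ₁(f)`» and «E-es-246 clause ⟺ E-es-244 clause»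
    (`lValue_not_mem_iff_ne_of_isNewformOf`): the Shimura-`5` index at `11` IS the `5`-integrality of `L(f,1)` against
    the `Γ₁(11)`-periods (BSD for `X₁(11)`: `L/Ω⁺(Λ₁) = 1/5²` vs `L/Ω⁺(Λ₀) = 1/5`);
  * `exists_latticeOptimalDatum_eleven` (⟸ `exists_isNewformOf` only): the class `11a` carries a lattice-optimal
    `X₀(11)`-datum on a globally minimal model — the level-`11` domain of C2-type statements is inhabited given modularity;
  * `squarefreeShimuraFiveLocus_inhabited` (⟸ E-es-244 + `exists_isNewformOf`): T-es-98's hypothesis locus is inhabited,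
    so together with T-es-98 the squarefree Shimura-`5` locus is EXACTLY `{11}` and non-empty (modulo those two inputs).

HONEST FRAMING: §1 is elementary and unconditional; §2's E-es-244/246 are printed mathematics stated as `Prop`s, not
proved; nothing here is a statement about `c_E` beyond bookkeeping; C2, Manin's conjecture and BSD are not proved by this.
[cite: LingOesterle1991, §1 and Thm. 1] [cite: Stevens1989, §2] [cite: Manin1972, Prop. 1.4 / Thm. 1.6]
[cite: CremonaAlgorithms1997, Table 1, N = 11] [this file; MEMO-es §69]
-/

set_option autoImplicit false

open scoped MatrixGroups ModularForm
open CongruenceSubgroup WeierstrassCurve Literature.NumberTheory.EllipticCurves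
open Literature.NumberTheory.EllipticCurves.ModularForms Literature.NumberTheory.Automorphic
open Summit.BirchSwinnertonDyer.Rank1Residual.ManinAdditive.KatoCurve (ShimuraIndexPrimeTo)

namespace Summit.BirchSwinnertonDyer.Rank1Residual.ManinAdditive.EsG45

/-! ## §1 The Shimura quotient at level `11` (fact-free) -/

/-- In `𝔽₁₁ˣ` every element satisfies `u⁵ = ±1` (Euler's criterion, `(11 − 1)/2 = 5`). [folklore] -/
theorem pow_five_eq_one_or_eq_neg_one_of_mul_eq_one :
    ∀ x y : ZMod 11, x * y = 1 → x ^ 5 = 1 ∨ x ^ 5 = -1 := by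
  decide

/-- `2` generates `𝔽₁₁ˣ`: every unit of `ℤ/11` is `2^k` with `k < 10`. [folklore] -/
theorem exists_eq_two_pow_of_mul_eq_one :
    ∀ x y : ZMod 11, x * y = 1 → ∃ k < 10, x = 2 ^ k := by
  decide

/-- The cyclicity hypothesis of `exists_eq_natCast_mul_cuspSymbol_add_of_generator` at `N = 11`, `u₀ = 2`. [folklore] -/
theorem units_eq_two_pow (u : (ZMod 11)ˣ) :
    ∃ k : ℕ, (u : ZMod 11) = 2 ^ k ∨ (u : ZMod 11) = -(2 ^ k) := by
  obtain ⟨k, -, hk⟩ := exists_eq_two_pow_of_mul_eq_one (u : ZMod 11) (↑u⁻¹ : ZMod 11) u.mul_inv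
  exact ⟨k, Or.inl hk⟩

/-- **`5·Λ₀(f) ⊆ Λ₁(f)` at level `11`**, for every `f ∈ S₂(Γ₀(11))`: each period is `{∞, γ∞}_f`
(`coe_periodLattice_eq_range`) and `d_γ⁵ ≡ ±1 (mod 11)` (`natCast_mul_cuspSymbol_mem_periodLatticeGamma1_of_pow_apply`).
[cite: LingOesterle1991, §1] [cite: Stevens1989, §2] -/
theorem five_mul_mem_periodLatticeGamma1 (f : CuspForm (Gamma0 11) 2) {z : ℂ} (hz : z ∈ periodLattice f) :
    (5 : ℂ) * z ∈ periodLatticeGamma1 f := by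
  have hz' : z ∈ (periodLattice f : Set ℂ) := hz
  rw [coe_periodLattice_eq_range] at hz'
  obtain ⟨γ, rfl⟩ := hz'
  obtain ⟨y, hy⟩ := (isUnit_apply_one_one γ).exists_right_inv
  exact_mod_cast natCast_mul_cuspSymbol_mem_periodLatticeGamma1_of_pow_apply f γ 5
    (pow_five_eq_one_or_eq_neg_one_of_mul_eq_one _ y hy)

/-- **`Λ₀(f) = ℕ·{∞, γ∞}_f + Λ₁(f)` for any `γ ∈ Γ₀(11)` with `d_γ ≡ 2 (mod 11)`** (the tree's cyclicity law with
`u₀ = 2`). [cite: LingOesterle1991, §1] [cite: Stevens1989, §2] -/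
theorem exists_eq_natCast_mul_cuspSymbol_add (f : CuspForm (Gamma0 11) 2) (γ : Gamma0 11)
    (hγ : (((γ : SL(2, ℤ)) 1 1 : ℤ) : ZMod 11) = 2) {z : ℂ} (hz : z ∈ periodLattice f) :
    ∃ (k : ℕ) (w : ℂ), w ∈ periodLatticeGamma1 f ∧ z = k * cuspSymbol f γ + w :=
  exists_eq_natCast_mul_cuspSymbol_add_of_generator f units_eq_two_pow γ hγ hz

/-- Such a `γ` exists (e.g. `(6 1; 11 2)`; Bézout). [cite: DiamondShurman2005, §1.2] -/
theorem exists_gamma0_eleven_apply_eq_two : ∃ γ : Gamma0 11, (((γ : SL(2, ℤ)) 1 1 : ℤ) : ZMod 11) = 2 :=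
  exists_gamma0_apply_one_one_eq_of_isUnit (isUnit_iff_exists_inv.mpr ⟨(6 : ZMod 11), by decide⟩)

/-- **`[Λ₀(f) : Λ₁(f)] ∈ {1, 5}` at level `11`**: every `z ∈ Λ₀(f)` is `k·{∞, γ∞}_f` modulo `Λ₁(f)` with `k < 5`
(`d_γ ≡ 2`). [cite: LingOesterle1991, §1 and Thm. 1] -/
theorem exists_lt_five_sub_natCast_mul_cuspSymbol_mem (f : CuspForm (Gamma0 11) 2) (γ : Gamma0 11)
    (hγ : (((γ : SL(2, ℤ)) 1 1 : ℤ) : ZMod 11) = 2) {z : ℂ} (hz : z ∈ periodLattice f) :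
    ∃ k : ℕ, k < 5 ∧ z - (k : ℂ) * cuspSymbol f γ ∈ periodLatticeGamma1 f := by
  obtain ⟨k, w, hw, rfl⟩ := exists_eq_natCast_mul_cuspSymbol_add f γ hγ hz
  have h5 : (5 : ℂ) * cuspSymbol f γ ∈ periodLatticeGamma1 f :=
    five_mul_mem_periodLatticeGamma1 f (cuspSymbol_mem_periodLattice f γ)
  refine ⟨k % 5, Nat.mod_lt _ (by norm_num), ?_⟩
  have hk : (k : ℂ) = 5 * ((k / 5 : ℕ) : ℂ) + ((k % 5 : ℕ) : ℂ) := by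
    exact_mod_cast (Nat.div_add_mod k 5).symm
  have : (k : ℂ) * cuspSymbol f γ + w - ((k % 5 : ℕ) : ℂ) * cuspSymbol f γ
      = ((k / 5 : ℕ) : ℂ) * ((5 : ℂ) * cuspSymbol f γ) + w := by
    rw [hk]; ring
  rw [this]
  refine add_mem ?_ hw
  rw [← nsmul_eq_mul]
  exact (periodLatticeGamma1 f).nsmul_mem h5 _

/-- **At level `11`, `5 ∤ [Λ₀(f) : Λ₁(f)]` iff `Λ₀(f) = Λ₁(f)`** (`5·Λ₀ ⊆ Λ₁` makes the no-`5`-torsion condition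
collapse the quotient). [cite: LingOesterle1991, §1 and Thm. 1] [this file; MEMO-es §69.2] -/
theorem shimuraIndexPrimeTo_five_iff_eq (f : CuspForm (Gamma0 11) 2) :
    ShimuraIndexPrimeTo 5 f ↔ periodLattice f = periodLatticeGamma1 f := by
  constructor
  · intro h
    refine le_antisymm (fun z hz ↦ h z hz ?_) (periodLatticeGamma1_le_periodLattice f)
    exact_mod_cast five_mul_mem_periodLatticeGamma1 f hz
  · intro h z hz _
    rw [← h]; exact hz

/-- **Single-membership form**: at level `11`, `5 ∤ [Λ₀(f) : Λ₁(f)]` iff the period `{∞, γ∞}_f` of one (any)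
`γ ∈ Γ₀(11)` with `d_γ ≡ 2 (mod 11)` is a `Γ₁(11)`-period. [cite: LingOesterle1991, §1] [this file; MEMO-es §69.2] -/
theorem shimuraIndexPrimeTo_five_iff_cuspSymbol_mem (f : CuspForm (Gamma0 11) 2) (γ : Gamma0 11)
    (hγ : (((γ : SL(2, ℤ)) 1 1 : ℤ) : ZMod 11) = 2) :
    ShimuraIndexPrimeTo 5 f ↔ cuspSymbol f γ ∈ periodLatticeGamma1 f := by
  rw [shimuraIndexPrimeTo_five_iff_eq]
  refine ⟨fun h ↦ h ▸ cuspSymbol_mem_periodLattice f γ, fun hγ1 ↦ ?_⟩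
  refine le_antisymm (fun z hz ↦ ?_) (periodLatticeGamma1_le_periodLattice f)
  obtain ⟨k, w, hw, rfl⟩ := exists_eq_natCast_mul_cuspSymbol_add f γ hγ hz
  refine add_mem ?_ hw
  rw [← nsmul_eq_mul]
  exact (periodLatticeGamma1 f).nsmul_mem hγ1 k

/-! ## §2 Typed candidates and the conditional inhabitant of the squarefree Shimura-`5` locus -/

/-- **E-es-244 `ShimuraFiveNonVacuousAtEleven`** — for every non-zero `f ∈ S₂(Γ₀(11))` the `Γ₁(11)`-periods are a PROPER
sublattice of the `Γ₀(11)`-periods (then of index exactly `5`, §1).  In print: `S₂(Γ₀(11)) = ℂ·f₁₁`, `X₁(11) → X₀(11)` is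
the `5`-isogeny `11a3 → 11a1` and `Λ₁(f₁₁) = Λ(11a3) ⊊ Λ(11a1) = Λ₀(f₁₁)` (Stevens `c₁ = 1`; Ling–Oesterlé `#Σ(11) = 5`;
CES 2003 Table 4, `11A`: `L/Ω = 1/5²` on `J₁(11)` vs Cremona `1/5` on `J₀(11)`).  NOT proved in the tree: the lattice
formalism bounds `[Λ₀ : Λ₁]` from above only; the witness needs the genus-one/Albanese input for `X₁(11)` or certified
periods.  Typed candidate, BC5 witness = `E15-LATTICE-INDEX-v1.tsv` row `N = 11` (index `5`).
[cite: LingOesterle1991, Thm. 1] [cite: Stevens1989, §2] [cite: CremonaAlgorithms1997, Table 1, N = 11] -/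
@[conjecture]
def ShimuraFiveNonVacuousAtEleven : Prop :=
  ∀ f : CuspForm (Gamma0 11) 2, f ≠ 0 → periodLattice f ≠ periodLatticeGamma1 f

/-- **E-es-245 `ShimuraFiveNonVacuousAtElevenData`** — datum form: every `X₀(11)`-datum has `5 ∣ [Λ₀(f) : Λ₁(f)]`.
PROVED ⟸ E-es-244 (`data_of_nonVacuous`). [cite: LingOesterle1991, Thm. 1] -/
@[conjecture]
def ShimuraFiveNonVacuousAtElevenData : Prop :=
  ∀ (W : WeierstrassCurve ℚ) [W.IsElliptic] (D : ModularParametrizationData W 11), ¬ ShimuraIndexPrimeTo 5 D.f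

/-- **E-es-246 `ShimuraFiveNonVacuousAtElevenLValue`** — es-lens / `L`-value form: `5·L(f,1) = 5·{∞,0}_f` is NOT a
`Γ₁(11)`-period.  Equivalent to E-es-244: for `γ₂ = (6 1; 11 2)`, `{∞, γ₂∞}_f = {0, γ₂0}_f = {0, ½}_f` and Manin's
`T₂`-relation `a₂{∞,0} = 2{∞,0} + {∞,½}` gives `{0,½}_f = −(1 + 2 − a₂)·{∞,0}_f = −5·L(f,1)` (`a₂(11a) = −2`), so by
`shimuraIndexPrimeTo_five_iff_cuspSymbol_mem` «`5·L(f,1) ∉ Λ₁`» ⟺ «`Λ₁ ≠ Λ₀`» (PROVED on the `11a`-newform in §3,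
`lValue_not_mem_iff_ne_of_isNewformOf`; for arbitrary `f ≠ 0` it is the same statement because `S₂(Γ₀(11))` is a line,
which the tree does not know); BSD dictionary: `L(f,1)/Ω⁺(Λ₀) = 1/5`, `L(f,1)/Ω⁺(Λ₁) = 1/5² = #Ш·c₁₁/#X₁(11)(ℚ)²`.
[cite: Manin1972, Prop. 1.4 / Thm. 1.6] [cite: CremonaAlgorithms1997, Table 1, N = 11] -/
@[conjecture]
def ShimuraFiveNonVacuousAtElevenLValue : Prop :=
  ∀ f : CuspForm (Gamma0 11) 2, f ≠ 0 → (5 : ℂ) * modularSymbol f 0 ∉ periodLatticeGamma1 f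

/-- The newform of an `X₀(N)`-datum is not the zero form (`a₁(f) = a₁(W) = 1`). [folklore] -/
theorem modularParametrizationData_f_ne_zero {W : WeierstrassCurve ℚ} [W.IsElliptic] {N : ℕ} [NeZero N]
    (D : ModularParametrizationData W N) : D.f ≠ 0 := by
  intro h0
  have h1 : cuspCoeff D.f 1 = 1 := by
    rw [D.isNewformOf.2 1]; exact_mod_cast W.isMultiplicative_LFunction.map_one
  rw [h0, cuspCoeff_zero_form (one_mem_strictPeriods_coe_gamma0 N) 1] at h1
  exact zero_ne_one h1

/-- **E-es-244 ⟹ E-es-245.** [this file; MEMO-es §69.3] -/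
theorem data_of_nonVacuous (h : ShimuraFiveNonVacuousAtEleven) : ShimuraFiveNonVacuousAtElevenData := by
  intro W _ D hS
  exact h D.f (modularParametrizationData_f_ne_zero D) ((shimuraIndexPrimeTo_five_iff_eq D.f).mp hS)

/-- **The class `11a` carries a lattice-optimal `X₀(11)`-datum on a globally minimal model, given modularity**
(`11A1 = [0,−1,1,−10,−20]`, conductor `11`; optimal relative `W₀` by `exists_optimal_modularParametrizationData_of_isNewformOf'`,
lattice clause by minimality of the degree, `latticeEq_of_forall_modularDegree_le`).  Conditional ONLY on
`exists_isNewformOf` (C2's own binder). [cite: CremonaAlgorithms1997, Table 1, N = 11, curve A1] -/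
theorem exists_latticeOptimalDatum_eleven (hnf : exists_isNewformOf) :
    ∃ (W₀ : WeierstrassCurve ℚ) (_ : W₀.IsElliptic) (_ : W₀.IsGloballyMinimal) (D₀ : ModularParametrizationData W₀ 11),
      X1Eleven.curve11A1.IsIsogenous W₀ ∧ ∀ z ∈ D₀.L.lattice, ∃ w ∈ periodLattice D₀.f, z = D₀.c * w := by
  haveI := BurungaleSkinner2023.isGloballyMinimal_curve11A1
  haveI := Curve11a.neZero_conductorNorm_curve11A1
  obtain ⟨f, hf⟩ := hnf X1Eleven.curve11A1
  suffices H : ∀ (M : ℕ) [NeZero M], X1Eleven.curve11A1.conductorNorm ℤ = M → M = 11 →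
      ∀ g : CuspForm (Gamma0 M) 2, IsNewformOf X1Eleven.curve11A1 g →
      ∃ (W₀ : WeierstrassCurve ℚ) (_ : W₀.IsElliptic) (_ : W₀.IsGloballyMinimal) (D₀ : ModularParametrizationData W₀ 11),
        X1Eleven.curve11A1.IsIsogenous W₀ ∧ ∀ z ∈ D₀.L.lattice, ∃ w ∈ periodLattice D₀.f, z = D₀.c * w from
    H _ rfl Curve11a.conductorNorm_curve11A1 f hf
  intro M _ hM hM11 g hg
  subst hM11
  obtain ⟨W₀, hE₀, hM₀, D₀, hf₀, hiso, hmin⟩ :=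
    exists_optimal_modularParametrizationData_of_isNewformOf' 11 X1Eleven.curve11A1 hM hg
  haveI := hE₀
  exact ⟨W₀, hE₀, hM₀, D₀, hiso, D₀.latticeEq_of_forall_modularDegree_le (by simpa [hf₀] using hmin)⟩

/-- **Non-vacuity of T-es-98's hypothesis locus, modulo {E-es-244, modularity}**: there are a globally minimal elliptic
`W₀/ℚ`, a SQUAREFREE level (`N = 11`) and a lattice-optimal `X₀(N)`-datum with `5 ∣ [Λ₀(f) : Λ₁(f)]`.  With T-es-98
(`ShimuraFiveSquarefreeOnlyAtEleven`: such a level IS `11`) the squarefree Shimura-`5` locus is exactly `{11}` and non-empty.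
[cite: LingOesterle1991, Thm. 1] [this file; MEMO-es §69.3] -/
theorem squarefreeShimuraFiveLocus_inhabited (h244 : ShimuraFiveNonVacuousAtEleven) (hnf : exists_isNewformOf) :
    ∃ (W₀ : WeierstrassCurve ℚ) (_ : W₀.IsElliptic) (_ : W₀.IsGloballyMinimal) (N : ℕ) (_ : NeZero N)
      (D₀ : ModularParametrizationData W₀ N),
      (∀ z ∈ D₀.L.lattice, ∃ w ∈ periodLattice D₀.f, z = D₀.c * w) ∧ Squarefree N ∧ ¬ ShimuraIndexPrimeTo 5 D₀.f := by
  obtain ⟨W₀, hE₀, hM₀, D₀, -, hopt⟩ := exists_latticeOptimalDatum_eleven hnf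
  haveI := hE₀
  exact ⟨W₀, hE₀, hM₀, 11, inferInstance, D₀, hopt, (by norm_num : Nat.Prime 11).prime.squarefree,
    data_of_nonVacuous h244 W₀ D₀⟩

/-! ## §3 `a₂(11a) = −2` and the es-lens identity `{∞, γ₂∞}_f = −5·L(f,1)` (fact-free; modularity only to name `f`) -/

/-- `γ₂ = (6 1; 11 2) ∈ Γ₀(11)` (`d ≡ 2`, `γ₂·0 = ½`, `γ₂·∞ = 6/11`). [cite: DiamondShurman2005, §1.2] -/
def gammaTwo : Gamma0 11 :=
  ⟨⟨!![6, 1; 11, 2], by rw [Matrix.det_fin_two_of]; norm_num⟩, by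
    rw [Gamma0_mem]
    show (((11 : ℤ) : ZMod 11)) = 0
    decide⟩

/-- The `(0,1)` entry of `γ₂` is `1`. [this file] -/
theorem gammaTwo_apply_zero_one : ((gammaTwo : SL(2, ℤ)) 0 1 : ℤ) = 1 := rfl
/-- The `(1,0)` entry of `γ₂` is `11`. [this file] -/
theorem gammaTwo_apply_one_zero : ((gammaTwo : SL(2, ℤ)) 1 0 : ℤ) = 11 := rfl
/-- The `(1,1)` entry of `γ₂` is `2`. [this file] -/
theorem gammaTwo_apply_one_one : ((gammaTwo : SL(2, ℤ)) 1 1 : ℤ) = 2 := rfl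

/-- The `(1,1)` entry of `γ₂` is `2` in `ZMod 11`. [this file] -/
theorem gammaTwo_apply_one_one_zmod : ((((gammaTwo : SL(2, ℤ)) 1 1 : ℤ)) : ZMod 11) = 2 := by
  rw [gammaTwo_apply_one_one]; rfl

/-- **Manin + Hecke at `2`: `{∞, γ∞}_f = (a₂(f) − 3)·{∞, 0}_f`** for a newform `f ∈ S₂(Γ₀(11))` and `γ ∈ Γ₀(11)` with
`b_γ = 1`, `d_γ = 2` (`{∞, γ0}_f = {∞, γ∞}_f + {∞, 0}_f`, `γ0 = ½`, and `a₂{∞,0} = {∞,0} + {∞,½} + {∞,0}`).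
[cite: Manin1972, Prop. 1.4 / Thm. 1.6] [cite: MazurTateTeitelbaum1986Invent, §I.4 (4.2)] -/
theorem cuspSymbol_eq_sub_three_mul (f : CuspForm (Gamma0 11) 2) (hf : IsNewform0 f)
    (γ : Gamma0 11) (h01 : ((γ : SL(2, ℤ)) 0 1 : ℤ) = 1) (h11 : ((γ : SL(2, ℤ)) 1 1 : ℤ) = 2) :
    cuspSymbol f γ = (cuspCoeff f 2 - 3) * modularSymbol f 0 := by
  -- Manin's relation at the cusp `0`: `{∞, γ0} = {∞, γ∞} + {∞, 0}`, `γ0 = b/d = 1/2`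
  have h01' : (((γ : SL(2, ℤ)) 0 1 : ℤ) : ℚ) = 1 := by exact_mod_cast h01
  have h11' : (((γ : SL(2, ℤ)) 1 1 : ℤ) : ℚ) = 2 := by exact_mod_cast h11
  have hM := modularSymbol_gamma0_smul_holds f γ 0 (by rw [mul_zero, zero_add, h11']; norm_num)
  rw [mul_zero, zero_add, mul_zero, zero_add, h01', h11'] at hM
  -- Hecke at `2`: `a₂ {∞,0} = {∞,0} + {∞,½} + {∞,0}`
  have hT := cuspCoeff_mul_modularSymbol 2 hf Nat.prime_two (by norm_num) 0
  rw [Fin.sum_univ_two] at hT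
  simp only [Fin.val_zero, Fin.val_one, Nat.cast_zero, Nat.cast_one, zero_add, mul_zero, zero_div,
    Nat.cast_ofNat] at hT
  -- combine
  rw [hM] at hT
  linear_combination (-1 : ℂ) * hT

/-- **es-lens form of the Shimura-`5` condition at level `11`** for a newform with `a₂(f) = −2`:
`5 ∤ [Λ₀(f) : Λ₁(f)]` iff `5·{∞,0}_f = 5·L(f,1)` is a `Γ₁(11)`-period. [this file; MEMO-es §69.4] -/
theorem shimuraIndexPrimeTo_five_iff_lValue_mem (f : CuspForm (Gamma0 11) 2) (hf : IsNewform0 f)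
    (h2 : cuspCoeff f 2 = -2) :
    ShimuraIndexPrimeTo 5 f ↔ (5 : ℂ) * modularSymbol f 0 ∈ periodLatticeGamma1 f := by
  rw [shimuraIndexPrimeTo_five_iff_cuspSymbol_mem f gammaTwo gammaTwo_apply_one_one_zmod,
    cuspSymbol_eq_sub_three_mul f hf gammaTwo gammaTwo_apply_zero_one gammaTwo_apply_one_one, h2,
    show (-2 - 3 : ℂ) * modularSymbol f 0 = -((5 : ℂ) * modularSymbol f 0) by ring, neg_mem_iff]

section APTwo

open Literature.NumberTheory.EllipticCurves.X1Eleven (curve11A1)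

/-- The integral model of the globally minimal `11A1 = [0,−1,1,−10,−20]` is itself. [cite: CremonaAlgorithms1997, Table 1, N = 11] -/
theorem integralModelInt_curve11A1 [curve11A1.IsGloballyMinimal] :
    integralModelInt curve11A1 = ⟨0, -1, 1, -10, -20⟩ := by
  apply WeierstrassCurve.map_injective (f := Int.castRingHom ℚ) Int.cast_injective
  simp only [map_integralModelInt]
  ext <;> simp [X1Eleven.curve11A1]

/-- **`#Ẽ(𝔽₂) = 5` for `11A1`** (`y² + y = x³ + x²` over `𝔽₂`: four affine points and `O`).
[cite: CremonaAlgorithms1997, Table 1, N = 11] -/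
theorem reductionPointCount_curve11A1_two [curve11A1.IsGloballyMinimal] : reductionPointCount curve11A1 2 = 5 := by
  rw [reductionPointCount, integralModelInt_curve11A1]
  have hmap : (⟨0, -1, 1, -10, -20⟩ : WeierstrassCurve ℤ).map (Int.castRingHom (ZMod 2)) = ⟨0, 1, 1, 0, 0⟩ := by
    ext <;> simp <;> decide
  rw [hmap, natCard_point_eq_one_add_card _ (by decide)]
  rfl

/-- **`a₂(11a) = −2`** (`a₂ = 2 + 1 − #Ẽ(𝔽₂) = 3 − 5`; good reduction at `2`, `LFunction_apply_prime_eq_frobeniusTrace`).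
[cite: CremonaAlgorithms1997, Table 1, N = 11 (a₂ = −2)] -/
theorem lFunction_two_curve11A1 : curve11A1.LFunction 2 = -2 := by
  haveI := BurungaleSkinner2023.isGloballyMinimal_curve11A1
  have hgood : curve11A1.HasGoodReductionAtPrime 2 :=
    BurungaleSkinner2023.hasGoodReductionAtPrime_curve11A1 (by norm_num)
  rw [curve11A1.LFunction_apply_prime_eq_frobeniusTrace 2 hgood, WeierstrassCurve.frobeniusTrace,
    reductionPointCount_curve11A1_two]
  norm_num

/-- For THE newform of `11a` (given as `IsNewformOf 11A1 f`): **`5 ∤ [Λ₀(f) : Λ₁(f)]` iff `5·L(f,1) ∈ Λ₁(f)`** — the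
Shimura-`5` index at `11` is exactly the integrality of `5·L(f,1)` against the `Γ₁(11)`-periods (BSD for `X₁(11)`
modulo `5`: `L/Ω⁺(Λ₁) = 1/5²`). [cite: CremonaAlgorithms1997, Table 1, N = 11] [this file; MEMO-es §69.4] -/
theorem shimuraIndexPrimeTo_five_iff_lValue_mem_of_isNewformOf (f : CuspForm (Gamma0 11) 2)
    (hf : IsNewformOf curve11A1 f) :
    ShimuraIndexPrimeTo 5 f ↔ (5 : ℂ) * modularSymbol f 0 ∈ periodLatticeGamma1 f :=
  shimuraIndexPrimeTo_five_iff_lValue_mem f hf.1 (by rw [hf.2 2, lFunction_two_curve11A1]; norm_num)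

/-- Hence on the `11a`-newform **E-es-246's clause ⟺ E-es-244's clause** (`5·L(f,1) ∉ Λ₁ ⟺ Λ₁ ≠ Λ₀`).
[this file; MEMO-es §69.4] -/
theorem lValue_not_mem_iff_ne_of_isNewformOf (f : CuspForm (Gamma0 11) 2) (hf : IsNewformOf curve11A1 f) :
    (5 : ℂ) * modularSymbol f 0 ∉ periodLatticeGamma1 f ↔ periodLattice f ≠ periodLatticeGamma1 f := by
  rw [← shimuraIndexPrimeTo_five_iff_lValue_mem_of_isNewformOf f hf, shimuraIndexPrimeTo_five_iff_eq]

end APTwo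

end Summit.BirchSwinnertonDyer.Rank1Residual.ManinAdditive.EsG45
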